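import Summits.BirchSwinnertonDyer.BirchSwinnertonDyer.Theorems.SchneiderFreeAdditiveX3AnticycControlAdditiveH2AnyTorsion
import Summits.BirchSwinnertonDyer.Rank1Residual.X11b.AnticyclotomicLevelStructure
import HarnessLib

/-!
# Crux `AnticycControlAdditiveKF` (route `SchneiderFreeAdditiveX3`, item stmt-BirchSwinnertonDyer-19548),
# regime B2 (item `ControlGlobalPTorsionF`, stmt-BirchSwinnertonDyer-19547) — the LEVEL/LIMIT relation
# WITH global `p`-torsion: `#H¹_{𝓛^{(k)}}(K, E[p^k]) = #E(K̄)[p^∞]^{Γ_K} · #Sel_𝔭^Σ(K, E[p^∞])`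

Seat `bsd-schneider-door-c4`, gen 3 (cell `bsd-schneider-ideate`). Route R1's passage from Castella's
Selmer group `Sel_𝔭^Σ(K, E[p^∞])` (`selmerAcBase`) to the Selmer group of the PROPAGATED finite-level
structure `𝓛^{(k)}` on `E[p^k]` (`AcSelmer.natCard_selmerAcBase_eq_natCard_level`, sub-cell multr1-p1)
uses the INJECTIVITY of `H¹(ι_k) : H¹(K, E[p^k]) → H¹(K, E[p^∞])`, i.e. `E(K̄)[p^∞]^{Γ_K} = 0`
(`E(K)[p] = 0`). On regime B2 of the control corner (`p = 3`, the `3`-torsion members of the door's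
X3 classes) this fails, and the exact relation is

  `#H¹_{𝓛^{(k)}}(K, E[p^k]) = #ker H¹(ι_k) · #Sel_𝔭^Σ(K, E[p^∞])`,  `#ker H¹(ι_k) = #E(K̄)[p^∞]^{Γ_K}`

for every `k` with `p^k · Sel_𝔭^Σ = 0` and `p^k · E(K̄)[p^∞]^{Γ_K} = 0`: `H¹_{𝓛^{(k)}} = H¹(ι_k)⁻¹(Sel)`
CONTAINS the kernel and maps ONTO `Sel = Sel[p^k]` (divisibility of `E[p^∞]`); and the kernel is the
image of the connecting homomorphism `δ : E(K̄)[p^∞]^{Γ_K} → H¹(K, E[p^k])`, whose kernel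
`p^k · E(K̄)[p^∞]^{Γ_K}` vanishes. door-c6's `natCard_ker_map_primaryInclusion_le` gave `≤`; here `=`.

* §1 `connectingClass_sub` — `δ(b) − δ(b') = δ(b − b')` (generic injective `i : A ↪ B`, `range i ⊇ B[n]`).
* §2 **`natCard_ker_map_primaryInclusion_eq`** — `#ker H¹(ι_k) = #E(K̄)[p^∞]^{Γ_K}` when `p^k` kills
  the invariants.
* §3 **`natCard_selmerGroup_acLevelStructure_eq_mul`**, **`natCard_level_eq_mul_natCard_selmerAcBase`** —
  the level/limit relation above (any number field `K`, any `W/K` elliptic, any `𝔭`, `Σ`).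

No hypothesis on `E(K)[p]`; no cited fact; no `Prop` fact minted; closes nothing by itself; BSD is not
proved by any of this.

References: [GreenbergLNM1716] §2 p. 63, §5 proof of Prop. 5.8; [JetchevSkinnerWan2017] §3.1–3.3
(arXiv:1512.06894 pp. 10–13); [SilvermanAEC2009] VIII.§2 (Kummer sequence).
-/

noncomputable section

open scoped Classical

open CategoryTheory Field NumberField IsDedekindDomain
open Literature.NumberTheory.EllipticCurves
open Literature.NumberTheory.GaloisRepresentations
open Literature.NumberTheory.GaloisRepresentations.DiscreteGaloisModule
open Literature.NumberTheory.GaloisCohomology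
open scoped ContRepresentation

set_option linter.dupNamespace false

namespace Summit.BirchSwinnertonDyer.BirchSwinnertonDyer.Theorems.SchneiderFreeAdditiveX3

open Summit.BirchSwinnertonDyer.Rank1Residual.X11b
open Summit.BirchSwinnertonDyer.Rank1Residual.X11b.Levels

/-! ## §1. `δ(b) − δ(b') = δ(b − b')` -/

section Generic

universe u

variable {F : Type u} [Field F] {A B : Type u} [AddCommGroup A] [TopologicalSpace A]
  [DiscreteTopology A] [AddCommGroup B] [TopologicalSpace B] [DiscreteTopology B]
  {ρA : DiscreteGaloisModule F A} {ρB : DiscreteGaloisModule F B}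

/-- For `b, b'` with `n • b`, `n • b'` invariant, `n • (b − b')` is invariant. [folklore] -/
theorem smul_nsmul_sub_eq {n : ℕ} {b b' : B}
    (hb : ∀ σ : absoluteGaloisGroup F, ρB σ (n • b) = n • b)
    (hb' : ∀ σ : absoluteGaloisGroup F, ρB σ (n • b') = n • b') (σ : absoluteGaloisGroup F) :
    ρB σ (n • (b - b')) = n • (b - b') := by
  rw [smul_sub, map_sub, hb σ, hb' σ]

/-- **`δ(b) − δ(b') = δ(b − b')`**: the connecting classes of the Kummer-type sequence
`0 → A —i→ B —n→ B` are additive in `b` (the lifted coboundary cocycles `σ ↦ i⁻¹(σ b − b)` are, by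
injectivity of `i`). Silverman, *AEC*, VIII.§2. [folklore] -/
theorem connectingClass_sub {i : ρA.toContRepresentation →ⁱL ρB.toContRepresentation} {n : ℕ}
    {hrange : ∀ b : B, n • b = 0 → ∃ a : A, i a = b} (hinj : Function.Injective i) (b b' : B)
    (hb : ∀ σ : absoluteGaloisGroup F, ρB σ (n • b) = n • b)
    (hb' : ∀ σ : absoluteGaloisGroup F, ρB σ (n • b') = n • b') :
    connectingClass i n hrange hinj b hb - connectingClass i n hrange hinj b' hb' =
      connectingClass i n hrange hinj (b - b') (smul_nsmul_sub_eq hb hb') := by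
  have key : oneCocycleClass ρA.toTopRep
      ((liftCocycle i n hrange hinj (Levels.cobCocycle ρB b) (nsmul_cobCocycle_apply_eq_zero n hb) -
        liftCocycle i n hrange hinj (Levels.cobCocycle ρB b') (nsmul_cobCocycle_apply_eq_zero n hb')) -
        liftCocycle i n hrange hinj (Levels.cobCocycle ρB (b - b'))
          (nsmul_cobCocycle_apply_eq_zero n (smul_nsmul_sub_eq hb hb'))) = 0 := by
    refine (oneCocycleClass_eq_zero_iff _ _).mpr ⟨0, fun σ ↦ hinj ?_⟩
    change i ((liftCocycle i n hrange hinj (Levels.cobCocycle ρB b) (nsmul_cobCocycle_apply_eq_zero n hb)).1 σ -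
        (liftCocycle i n hrange hinj (Levels.cobCocycle ρB b') (nsmul_cobCocycle_apply_eq_zero n hb')).1 σ -
        (liftCocycle i n hrange hinj (Levels.cobCocycle ρB (b - b'))
          (nsmul_cobCocycle_apply_eq_zero n (smul_nsmul_sub_eq hb hb'))).1 σ) =
      i (ρA.toTopRep.ρ σ 0 - 0)
    rw [map_sub, map_sub, apply_liftCocycle hinj, apply_liftCocycle hinj, apply_liftCocycle hinj,
      Levels.cobCocycle_apply, Levels.cobCocycle_apply, Levels.cobCocycle_apply, map_zero, sub_zero, map_zero, map_sub]
    abel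
  rw [oneCocycleClass_sub, oneCocycleClass_sub, sub_eq_zero] at key
  exact key

end Generic

/-! ## §2. `#ker (H¹(K, E[p^k]) → H¹(K, E[p^∞])) = #E(K̄)[p^∞]^{Γ_K}` when `p^k` kills the invariants -/

section KernelCurve

variable {K : Type} [Field K] [NumberField K] (W : WeierstrassCurve K) [W.IsElliptic] (p k : ℕ)
  [Fact p.Prime]

omit [NumberField K] in
/-- **`#ker H¹(ι_k) = #E(K̄)[p^∞]^{Γ_K}` as soon as `p^k · E(K̄)[p^∞]^{Γ_K} = 0`**: the map
`R ↦ δ(b_R)` (`p^k b_R = R`, divisibility of `E[p^∞]`) of door-c6's `natCard_ker_map_primaryInclusion_le`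
is onto the kernel (`Levels.map_primaryInclusion_eq_zero_iff`, `connectingClass_eq_of_nsmul_eq`) and
INJECTIVE: `δ(b_R) = δ(b_{R'})` gives `δ(b_R − b_{R'}) = 0` (`connectingClass_sub`), i.e. an invariant
`b₀` with `p^k b₀ = R − R'` (`Levels.connectingClass_eq_zero_iff`), and `p^k b₀ = 0`.
[cite: GreenbergLNM1716, §2 p. 63 and §5 proof of Prop. 5.8] [cite: SilvermanAEC2009, VIII.§2] -/
theorem natCard_ker_map_primaryInclusion_eq
    (hk : ∀ m : W.geomPrimaryTorsion p, (∀ σ : absoluteGaloisGroup K, σ • m = m) → p ^ k • m = 0) :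
    Nat.card (galoisCohomology.map (primaryInclusion W p k) 1).ker =
      Nat.card {m : W.geomPrimaryTorsion p | ∀ σ : absoluteGaloisGroup K, σ • m = m} := by
  have hdiv : W.zsmul_geomPoints_surjective := W.zsmul_geomPoints_surjective_holds
  -- a `p^k`-th root of each invariant point, and its connecting class
  have hroot : ∀ R : {m : W.geomPrimaryTorsion p | ∀ σ : absoluteGaloisGroup K, σ • m = m},
      ∃ b : W.geomPrimaryTorsion p, p ^ k • b = (R : W.geomPrimaryTorsion p) := fun R ↦
    exists_pow_nsmul_eq_geomPrimaryTorsion W p k hdiv _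
  choose root hroot using hroot
  have hfix : ∀ R : {m : W.geomPrimaryTorsion p | ∀ σ : absoluteGaloisGroup K, σ • m = m},
      ∀ σ : absoluteGaloisGroup K,
        LocBridge.primaryGaloisModule W p σ (p ^ k • root R) = p ^ k • root R := fun R σ ↦ by
    rw [hroot R]; exact R.2 σ
  let ψ : {m : W.geomPrimaryTorsion p | ∀ σ : absoluteGaloisGroup K, σ • m = m} →
      (galoisCohomology.map (primaryInclusion W p k) 1).ker := fun R ↦
    ⟨connectingClass (primaryInclusion W p k) (p ^ k) (exists_primaryInclusion_eq_of_nsmul_eq_zero W p k)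
        (primaryInclusion_injective W p k) (root R) (hfix R),
      (AddMonoidHom.mem_ker).2 (map_connectingClass (primaryInclusion_injective W p k) _ (hfix R))⟩
  refine (Nat.card_congr (Equiv.ofBijective ψ ⟨?_, ?_⟩)).symm
  · -- injective
    intro R R' hRR'
    have h1 := congrArg Subtype.val hRR'
    change connectingClass (primaryInclusion W p k) (p ^ k)
        (exists_primaryInclusion_eq_of_nsmul_eq_zero W p k) (primaryInclusion_injective W p k)
        (root R) (hfix R) =
      connectingClass (primaryInclusion W p k) (p ^ k)
        (exists_primaryInclusion_eq_of_nsmul_eq_zero W p k) (primaryInclusion_injective W p k)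
        (root R') (hfix R') at h1
    rw [← sub_eq_zero, connectingClass_sub (primaryInclusion_injective W p k),
      connectingClass_eq_zero_iff (primaryInclusion_injective W p k)
        (pow_nsmul_geomTorsion_eq_zero W p k)] at h1
    obtain ⟨b₀, hb₀, hb₀k⟩ := h1
    have hb₀0 : p ^ k • b₀ = 0 := hk b₀ (fun σ ↦ hb₀ σ)
    rw [hb₀0, smul_sub, hroot R, hroot R', eq_comm, sub_eq_zero] at hb₀k
    exact Subtype.ext hb₀k
  · -- surjective (door-c6)
    rintro ⟨c, hc⟩
    obtain ⟨b, hb, hcb⟩ := (map_primaryInclusion_eq_zero_iff W p k c).mp ((AddMonoidHom.mem_ker).1 hc)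
    refine ⟨⟨p ^ k • b, (fun σ ↦ hb σ : ∀ σ : absoluteGaloisGroup K, σ • (p ^ k • b) = p ^ k • b)⟩,
      Subtype.ext ?_⟩
    exact (connectingClass_eq_of_nsmul_eq (primaryInclusion_injective W p k) _ b (hfix _) hb
      (hroot _)).trans hcb.symm

end KernelCurve

/-! ## §3. The level/limit relation `#H¹_{𝓛^{(k)}}(K, E[p^k]) = #E(K̄)[p^∞]^{Γ_K} · #H¹_{𝓛^{ac,Σ}}(K, E[p^∞])` -/

section Level

variable {K : Type} [Field K] [NumberField K] (W : WeierstrassCurve K) [W.IsElliptic] (p k : ℕ)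
  [Fact p.Prime] (𝔭 : HeightOneSpectrum (𝓞 K)) (S : Set (HeightOneSpectrum (𝓞 K)))

/-- **`#H¹_{𝓛^{(k)}}(K, E[p^k]) = #ker H¹(ι_k) · #H¹_{𝓛^{ac,Σ}}(K, E[p^∞])` when `p^k` kills the
latter** (NO hypothesis on the invariants): the propagated level group `H¹(ι_k)⁻¹(H¹_{𝓛^{ac,Σ}})`
contains `ker H¹(ι_k)` and maps onto `H¹_{𝓛^{ac,Σ}} = H¹_{𝓛^{ac,Σ}}[p^k] ⊆ im H¹(ι_k)` (divisibility of
`E[p^∞]`, `AcSelmer.exists_map_eq_of_mem_of_nsmul_eq_zero`). multr1-p1's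
`AcSelmer.natCard_selmerGroup_acLevelStructure_eq` is the case `ker H¹(ι_k) = 0`.
[cite: GreenbergLNM1716, §5 proof of Prop. 5.8] [cite: JetchevSkinnerWan2017, §3.1–3.3 (arXiv:1512.06894 pp. 10–13)] -/
theorem natCard_selmerGroup_acLevelStructure_eq_ker_mul
    (hk : ∀ x ∈ (AcSelmer.acStructure (LocBridge.primaryGaloisModule W p) p 𝔭 S).selmerGroup,
      p ^ k • x = 0) :
    Nat.card (AcSelmer.acLevelStructure W p k 𝔭 S).selmerGroup =
      Nat.card (galoisCohomology.map (primaryInclusion W p k) 1).ker *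
        Nat.card (AcSelmer.acStructure (LocBridge.primaryGaloisModule W p) p 𝔭 S).selmerGroup := by
  have hdiv : W.zsmul_geomPoints_surjective := W.zsmul_geomPoints_surjective_holds
  set φ := galoisCohomology.map (primaryInclusion W p k) 1 with hφ
  set M := (AcSelmer.acStructure (LocBridge.primaryGaloisModule W p) p 𝔭 S).selmerGroup with hM
  rw [AcSelmer.selmerGroup_acLevelStructure]
  change Nat.card ↥(M.comap φ) = Nat.card φ.ker * Nat.card M
  -- the restricted map `F : φ⁻¹(M) → M`
  let F : M.comap φ →+ M := φ.addSubgroupComap M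
  have hFsurj : Function.Surjective F := by
    rintro ⟨x, hx⟩
    obtain ⟨c, rfl⟩ := (mem_range_map_primaryInclusion_iff W p k hdiv x).mpr (hk x hx)
    exact ⟨⟨c, hx⟩, rfl⟩
  -- its kernel is `ker φ`
  have hker : Nat.card F.ker = Nat.card φ.ker := by
    refine Nat.card_congr ⟨fun c ↦ ⟨(c.1 : _), ?_⟩, fun c ↦ ⟨⟨c.1, ?_⟩, ?_⟩, fun c ↦ rfl, fun c ↦ rfl⟩
    · exact congrArg Subtype.val ((AddMonoidHom.mem_ker).mp c.2)
    · have h0 : φ c.1 = 0 := (AddMonoidHom.mem_ker).mp c.2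
      change φ c.1 ∈ M
      rw [h0]; exact M.zero_mem
    · exact (AddMonoidHom.mem_ker).mpr (Subtype.ext ((AddMonoidHom.mem_ker).mp c.2))
  rw [AddSubgroup.card_eq_card_quotient_mul_card_addSubgroup F.ker,
    Nat.card_congr (QuotientAddGroup.quotientKerEquivOfSurjective F hFsurj).toEquiv, hker, mul_comm]

/-- **The level/limit relation with global `p`-torsion:
`#H¹_{𝓛^{(k)}}(K, E[p^k]) = #E(K̄)[p^∞]^{Γ_K} · #H¹_{𝓛^{ac,Σ}}(K, E[p^∞])`** for every `k` such that
`p^k` kills both `H¹_{𝓛^{ac,Σ}}(K, E[p^∞])` and `E(K̄)[p^∞]^{Γ_K}` (e.g. `k ≥` the exponents of these two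
finite groups). [cite: GreenbergLNM1716, §2 p. 63 and §5 proof of Prop. 5.8] -/
theorem natCard_selmerGroup_acLevelStructure_eq_mul
    (hkΓ : ∀ m : W.geomPrimaryTorsion p, (∀ σ : absoluteGaloisGroup K, σ • m = m) → p ^ k • m = 0)
    (hk : ∀ x ∈ (AcSelmer.acStructure (LocBridge.primaryGaloisModule W p) p 𝔭 S).selmerGroup,
      p ^ k • x = 0) :
    Nat.card (AcSelmer.acLevelStructure W p k 𝔭 S).selmerGroup =
      Nat.card {m : W.geomPrimaryTorsion p | ∀ σ : absoluteGaloisGroup K, σ • m = m} *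
        Nat.card (AcSelmer.acStructure (LocBridge.primaryGaloisModule W p) p 𝔭 S).selmerGroup := by
  rw [natCard_selmerGroup_acLevelStructure_eq_ker_mul W p k 𝔭 S hk,
    natCard_ker_map_primaryInclusion_eq W p k hkΓ]

/-- **Route-R1 form: `#H¹_{𝓛^{(k)}}(K, E[p^k]) = #E(K̄)[p^∞]^{Γ_K} · #Sel_𝔭^Σ(K, E[p^∞])`** (Castella's
Selmer group over `K`, `selmerAcBase`), for every `k` with `p^k · Sel_𝔭^Σ = 0` and
`p^k · E(K̄)[p^∞]^{Γ_K} = 0`. multr1-p1's `AcSelmer.natCard_selmerAcBase_eq_natCard_level` is the case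
`E(K̄)[p^∞]^{Γ_K} = 0`. [cite: Castella2018, Def. 2.2 (arXiv:1704.06608 p. 5)]
[cite: GreenbergLNM1716, §5 proof of Prop. 5.8] -/
theorem natCard_level_eq_mul_natCard_selmerAcBase
    (hkΓ : ∀ m : W.geomPrimaryTorsion p, (∀ σ : absoluteGaloisGroup K, σ • m = m) → p ^ k • m = 0)
    (hk : ∀ x ∈ (AcSelmer.acStructure (LocBridge.primaryGaloisModule W p) p 𝔭 S).selmerGroup,
      p ^ k • x = 0) :
    Nat.card (AcSelmer.acLevelStructure W p k 𝔭 S).selmerGroup =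
      Nat.card {m : W.geomPrimaryTorsion p | ∀ σ : absoluteGaloisGroup K, σ • m = m} *
        Nat.card (AcSelmer.selmerAcBase W p 𝔭 S) := by
  rw [AcSelmer.natCard_selmerAcBase_eq_natCard_selmerGroup,
    natCard_selmerGroup_acLevelStructure_eq_mul W p k 𝔭 S hkΓ hk]

end Level

end Summit.BirchSwinnertonDyer.BirchSwinnertonDyer.Theorems.SchneiderFreeAdditiveX3

end
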